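import Summits.ResolutionOfSingularities.ResolutionOfSingularities.Theorems.FrobeniusLadderFInjectiveMacaulayficationRMonoidBlowup
import Summits.ResolutionOfSingularities.ResolutionOfSingularities.Theorems.FrobeniusLadderFInjectiveMacaulayficationRMonoidDefs
import Summits.ResolutionOfSingularities.ResolutionOfSingularities.Theorems.FrobeniusLadderFInjectiveMacaulayficationTStepOfProduct
import Summits.ResolutionOfSingularities.ResolutionOfSingularities.Theorems.WildQuotientsWildQuotientResolutionToricChartLemmas
import Summits.ResolutionOfSingularities.ResolutionOfSingularities.Theorems.WildQuotientsWildQuotientResolutionToricChartNoetherian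
import Summits.ResolutionOfSingularities.ResolutionOfSingularities.Theorems.WildQuotientsWildQuotientResolutionToricChartWords
import HarnessLib

/-!
# (T-I3b) ★★★ T″-INSTANCE #6 — THE RECURRENT MONOID HABITAT: for the LOOPING floor `Bl_{Sing_red} U_R` a ONE-blow-up fibre-supported cure exists (every field, every `p`)
# (crux `FInjectiveMacaulayfication` stmt-ResolutionOfSingularities-15315, chain w45a, door v41.1 «full-to-regular door»; #3b of `Cruxes/…/Lines/T-I3b-spec.md`;
# seat res-L1-w45a-lead-1 g12 on res-L1-w45a-plan-1's RULING 2026-08-29T02:33:49Z)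

[OURS · L1 W4.5a] Support file (`--supports stmt-ResolutionOfSingularities-15315 --as helper`); replaces the role of NO printed item; NOT a statement of any manuscript;
def-free; UNCONDITIONAL; no named fact. AI-written (AI review is weaker than expert review).

THE HABITAT (the cone datum `D`, floor words `GJ` and cure words `GK` enter as binders with defining equations — literally `rDatum`, `rJ`, `rK` of
`…RMonoidDefs`). `U_R = Spec k[R]`, `k[R] = ToricChart.Ring k PEmpty D ≅ k[x₁,x₃,x₄,x₂x₃x₄,x₂x₄²,x₁x₂x₄,x₁x₂x₃]` (res-L1-w45a-tri-2's universal recurrent monoid,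
TRIAGE #725: the common ancestral chart of all nine `Sing_red`-looping admissible towers; a normal Gorenstein NON-hypersurface toric 4-fold singular along three curves meeting at
the torus fixed point `x`). FLOOR `J = spanWords GJ` = the reduced ideal of `Sing U_R`; `X₁ = Bl_J U_R` is the floor on which the memoryless recipe «blow up `Sing_red`» LOOPS
(`Bl_{Sing_red} X₁` has three charts `≅ U_R`). CURE: the `𝔪_x`-primary monomial ideal `K″ = spanWords GK` (34 generators; `Σ_{K″} = star_b(σ)` refined at three index-2 points);
`Bl_{J·K″} U_R` is REGULAR (✓ `RMonoidBlowup.blowup_regular`: 28 affine-space charts, kernel-certified), and `Bl_{J·K″} U_R → X₁` is the blowing up of `K″·𝒪_{X₁}`, an ideal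
cosupported on the fibre over `x` — so the PRODUCT ROUTE ✓ `TStepOfProduct.tStepInstanceAt_of_product` applies.

* `isMaximal_conePoint` — the cone point `𝔪 = (x₁, x₃, x₄, x₂x₃x₄, x₂x₄², x₁x₂x₄, x₁x₂x₃)` (the seven non-dummy symbols) is a maximal ideal of `k[R]` (it is the kernel of
  `evaluation at 0 ∘ θ`; every monomial of `θ a` is a word monomial, `ToricChart.exists_word_of_mem_support`).
* `pow_mem_K` — every generator of `𝔪` has a power in `K″` (`x₁⁹, x₃⁹, x₄⁵, (x₂x₃x₄)⁵, (x₂x₄²)³, (x₁x₂x₄)⁵, (x₁x₂x₃)⁹ ∈ K″` are generators 14, 4, 0, 7, 3, 12, 15).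
* ★★★ `tStepInstanceAt_recurrentMonoid` (binder form) / `tStepInstanceAt_recurrentMonoid_rDatum` (named bed, ✓p694456 `…RMonoidDefs`) — for EVERY field `k`, every `p`
  and the cone point `x`: `TStepInstanceAt p x (J̃·𝒪_{U_R,x})` — for every blowing up
  `S′ → Spec 𝒪_{U_R,x}` along `J` (regular off the closed fibre, FULL), there is a fibre-supported `𝓚 ≠ ⊥` on `S′` ALL of whose blowings up are regular. SIXTH kernel
  T″-instance, the FIRST on a non-hypersurface bed, the first with a non-isolated singular locus, and the first whose floor is one on which `𝓚 = I(Sing_red)` provably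
  does NOT work. HONEST BILLING: the instance holds unconditionally but is NON-VACUOUS only if the floor `X₁` is FULL at every stalk — on paper true (all seven Rees
  charts of `X₁` are saturated: three `≅ U_R`, one regular, three `𝔸¹ × node`; normal toric ⇒ Cohen–Macaulay ∧ F-pure) but that rests on the RESERVED print T-TOR
  (Hochster) for the three `≅ U_R` charts and is NOT claimed here (desk NOTE l.85007: hypothesis-form); the `𝔸¹ × node` charts are FULL by ✓ `SegreConeFull`. ONE
  instance; evidence for nothing beyond itself; the T″ stub `stub_localRegularizationFibreFullTr` and the F-half stay OPEN; nothing of the crux is proved.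
[folklore assembly; cite: StacksProject, Tag 080A; GortzWedhorn2020, Prop. 13.91 (2); CoxLittleSchenck2011, Thm. 11.1.9 (context)]
-/

-- single-problem summit: the doubled namespace component is forced
set_option linter.dupNamespace false

noncomputable section

namespace Summit.ResolutionOfSingularities.ResolutionOfSingularities.Theorems.FInjectiveMacaulayfication.RMonoidTStep

open MvPolynomial AlgebraicGeometry CategoryTheory
open Literature.AlgebraicGeometry.Resolution
open Summit.ResolutionOfSingularities.ResolutionOfSingularities.Theorems.WildQuotientResolution.ToricChart
open Summit.ResolutionOfSingularities.ResolutionOfSingularities.Theorems.FInjectiveMacaulayfication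

variable (k : Type) [Field k]

/-! ## §1 Word arithmetic in the cone ring `k[R]` -/

/-- A power of a word element is the word element of any word with the multiplied exponent. [folklore] -/
theorem pow_eq_wordElem {P : Type} {d r : ℕ} (D : ConeDatum d r) (w W : Word d r) (n : ℕ) (h : wordExp D W = n • wordExp D w) :
    wordElem k P D w ^ n = wordElem k P D W :=
  theta_injective (by rw [map_pow, theta_wordElem, theta_wordElem, h, xmon_smul])

/-- Evaluation at the origin kills every word monomial with a nonzero exponent. [folklore] -/
theorem aeval_zero_theta_wordElem {P : Type} {d r : ℕ} (D : ConeDatum d r) (w : Word d r) (s : Fin d) (hs : wordExp D w s ≠ 0) :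
    MvPolynomial.aeval (0 : Fin d ⊕ P → k) (theta (wordElem k P D w)) = 0 := by
  rw [theta_wordElem, xmon, map_prod]
  exact Finset.prod_eq_zero (Finset.mem_univ s) (by rw [map_pow, aeval_X, Pi.zero_apply, zero_pow hs])

/-- A word of the cone datum `D = rDatum` all of whose non-dummy multiplicities vanish has exponent `0`. [OURS · computation] -/
theorem wordExp_eq_zero (D : ConeDatum 4 4) (hD : D = ⟨![1, 0, 1, 1], ![![0, 1, 1, 1], ![0, 1, 0, 2], ![1, 1, 0, 1], ![1, 1, 1, 0]]⟩) (w : Word 4 4) (h0 : w.wp 0 = 0) (h2 : w.wp 2 = 0) (h3 : w.wp 3 = 0)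
    (m0 : w.wm 0 = 0) (m1 : w.wm 1 = 0) (m2 : w.wm 2 = 0) (m3 : w.wm 3 = 0) : wordExp D w = 0 := by
  subst hD
  funext t
  fin_cases t <;> simp [wordExp, fsum, h0, h2, h3, m0, m1, m2, m3]

/-- Peeling one letter off a word: if the pure symbol `s` occurs in `w`, then `wordExp w = wordExp (pureWord s) + wordExp w′` for a word `w′`. [OURS · computation] -/
theorem exists_wordExp_eq_add_pure (D : ConeDatum 4 4) (hD : D = ⟨![1, 0, 1, 1], ![![0, 1, 1, 1], ![0, 1, 0, 2], ![1, 1, 0, 1], ![1, 1, 1, 0]]⟩) (w : Word 4 4) (s : Fin 4) (hs : 0 < w.wp s) :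
    ∃ w' : Word 4 4, wordExp D w = wordExp D (pureWord s) + wordExp D w' := by
  subst hD
  refine ⟨⟨Function.update w.wp s (w.wp s - 1), w.wm⟩, ?_⟩
  funext t
  fin_cases s <;> fin_cases t <;> simp [wordExp, fsum, pureWord] at hs ⊢ <;> omega

/-- Peeling one letter off a word: if the mixed symbol `j` occurs in `w`, then `wordExp w = wordExp (mixedWord j) + wordExp w′` for a word `w′`. [OURS · computation] -/
theorem exists_wordExp_eq_add_mixed (D : ConeDatum 4 4) (hD : D = ⟨![1, 0, 1, 1], ![![0, 1, 1, 1], ![0, 1, 0, 2], ![1, 1, 0, 1], ![1, 1, 1, 0]]⟩) (w : Word 4 4) (j : Fin 4) (hj : 0 < w.wm j) :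
    ∃ w' : Word 4 4, wordExp D w = wordExp D (mixedWord j) + wordExp D w' := by
  subst hD
  refine ⟨⟨w.wp, Function.update w.wm j (w.wm j - 1)⟩, ?_⟩
  funext t
  fin_cases j <;> fin_cases t <;> simp [wordExp, fsum, mixedWord] at hj ⊢ <;> omega

/-! ## §2 The cone point is a maximal ideal; its generators have powers in `K″` -/

/-- ★ **The cone point of `U_R` is a maximal ideal**: `𝔪 = (x₁, x₃, x₄, x₂x₃x₄, x₂x₄², x₁x₂x₄, x₁x₂x₃)` — the seven non-dummy symbols of `rDatum` — is the kernel of the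
surjection `k[R] → k`, «evaluate at the origin» `∘ θ`: every monomial of `θ a` is a word monomial (`ToricChart.exists_word_of_mem_support`), and a word monomial with nonzero
exponent is divisible by one of the seven symbols. [OURS; folklore] -/
theorem isMaximal_conePoint (D : ConeDatum 4 4) (hD : D = ⟨![1, 0, 1, 1], ![![0, 1, 1, 1], ![0, 1, 0, 2], ![1, 1, 0, 1], ![1, 1, 1, 0]]⟩) :
    (spanWords k PEmpty D ![pureWord 0, pureWord 2, pureWord 3, mixedWord 0, mixedWord 1, mixedWord 2, mixedWord 3]).IsMaximal := by
  classical
  obtain ⟨χ, hχ⟩ : ∃ χ : Ring k PEmpty D →ₐ[k] k, ∀ a, χ a = MvPolynomial.aeval (0 : Fin 4 ⊕ PEmpty → k) (theta a) :=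
    ⟨(MvPolynomial.aeval (0 : Fin 4 ⊕ PEmpty → k)).comp theta, fun a => rfl⟩
  have hsurj : Function.Surjective χ := fun c => ⟨algebraMap k (Ring k PEmpty D) c, by rw [AlgHom.commutes]; rfl⟩
  have hker : (RingHom.ker χ).IsMaximal := RingHom.ker_isMaximal_of_surjective χ hsurj
  suffices heq : spanWords k PEmpty D ![pureWord 0, pureWord 2, pureWord 3, mixedWord 0, mixedWord 1, mixedWord 2, mixedWord 3] = RingHom.ker χ by
    rw [heq]; exact hker
  apply le_antisymm
  · -- the seven symbols vanish at the origin
    rw [spanWords, Ideal.span_le]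
    rintro _ ⟨i, rfl⟩
    rw [SetLike.mem_coe, RingHom.mem_ker, hχ]
    fin_cases i
    · exact aeval_zero_theta_wordElem k D (pureWord 0) 0 (by subst hD; decide)
    · exact aeval_zero_theta_wordElem k D (pureWord 2) 2 (by subst hD; decide)
    · exact aeval_zero_theta_wordElem k D (pureWord 3) 3 (by subst hD; decide)
    · exact aeval_zero_theta_wordElem k D (mixedWord 0) 1 (by subst hD; decide)
    · exact aeval_zero_theta_wordElem k D (mixedWord 1) 1 (by subst hD; decide)
    · exact aeval_zero_theta_wordElem k D (mixedWord 2) 0 (by subst hD; decide)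
    · exact aeval_zero_theta_wordElem k D (mixedWord 3) 0 (by subst hD; decide)
  · -- an element killed by `χ` has no constant monomial, so every monomial of `θ a` is a word monomial with a nonzero exponent, divisible by a symbol
    intro a ha
    rw [RingHom.mem_ker, hχ, MvPolynomial.aeval_zero] at ha
    have h0 : coeff 0 (theta a) = 0 := by simpa [MvPolynomial.constantCoeff_eq] using ha
    refine mem_spanWords_of_forall_EG (fun e => ∃ w : Word 4 4, wordExp D w = e) (fun e h => h) _ fun mo hmo => ?_
    obtain ⟨w, hw⟩ := exists_word_of_mem_support a mo hmo
    -- `mo ≠ 0`, and `mo` has no passenger part, so `wordExp w = dist mo ≠ 0`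
    have hmo0 : mo ≠ 0 := by
      rintro rfl
      exact (MvPolynomial.mem_support_iff.mp hmo) h0
    have hne : wordExp D w ≠ 0 := by
      intro hz
      apply hmo0
      ext v
      rcases v with s | p
      · have := congrFun hw s
        rw [hz] at this
        show mo (Sum.inl s) = 0
        exact this.symm
      · exact p.elim
    -- some non-dummy letter occurs in `w`
    have hletter : 0 < w.wp 0 ∨ 0 < w.wp 2 ∨ 0 < w.wp 3 ∨ 0 < w.wm 0 ∨ 0 < w.wm 1 ∨ 0 < w.wm 2 ∨ 0 < w.wm 3 := by
      by_contra hcon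
      simp only [not_or, not_lt, Nat.le_zero] at hcon
      obtain ⟨a0, a2, a3, b0, b1, b2, b3⟩ := hcon
      exact hne (wordExp_eq_zero D hD w a0 a2 a3 b0 b1 b2 b3)
    -- peel it off: `dist mo = wordExp (U l) + wordExp w′`
    have peel : ∀ (l : Fin 7) (w' : Word 4 4),
        wordExp D w = wordExp D (![pureWord 0, pureWord 2, pureWord 3, mixedWord 0, mixedWord 1, mixedWord 2, mixedWord 3] l) + wordExp D w' →
        dist mo ∈ EG (fun e => ∃ w : Word 4 4, wordExp D w = e) D
          ![pureWord 0, pureWord 2, pureWord 3, mixedWord 0, mixedWord 1, mixedWord 2, mixedWord 3] := by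
      intro l w' hlw
      refine EG.of_eq l ⟨w', rfl⟩ ?_
      rw [← hw, hlw]
    rcases hletter with h | h | h | h | h | h | h
    · obtain ⟨w', hw'⟩ := exists_wordExp_eq_add_pure D hD w 0 h; exact peel 0 w' hw'
    · obtain ⟨w', hw'⟩ := exists_wordExp_eq_add_pure D hD w 2 h; exact peel 1 w' hw'
    · obtain ⟨w', hw'⟩ := exists_wordExp_eq_add_pure D hD w 3 h; exact peel 2 w' hw'
    · obtain ⟨w', hw'⟩ := exists_wordExp_eq_add_mixed D hD w 0 h; exact peel 3 w' hw'
    · obtain ⟨w', hw'⟩ := exists_wordExp_eq_add_mixed D hD w 1 h; exact peel 4 w' hw'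
    · obtain ⟨w', hw'⟩ := exists_wordExp_eq_add_mixed D hD w 2 h; exact peel 5 w' hw'
    · obtain ⟨w', hw'⟩ := exists_wordExp_eq_add_mixed D hD w 3 h; exact peel 6 w' hw'

/-- **Every generator of the cone point has a power in `K″`** (`x₁⁹ = GK 14`, `x₃⁹ = GK 4`, `x₄⁵ = GK 0`, `(x₂x₃x₄)⁵ = GK 7`, `(x₂x₄²)³ = GK 3`, `(x₁x₂x₄)⁵ = GK 12`,
`(x₁x₂x₃)⁹ = GK 15`), so `V(K″) ⊆ {𝔪}`. [OURS · computation] -/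
theorem pow_mem_K (D : ConeDatum 4 4) (hD : D = ⟨![1, 0, 1, 1], ![![0, 1, 1, 1], ![0, 1, 0, 2], ![1, 1, 0, 1], ![1, 1, 1, 0]]⟩)
    (GK : Fin 34 → Word 4 4)
    (hGK : GK = ![⟨![0, 0, 0, 5], ![0, 0, 0, 0]⟩, ⟨![0, 0, 1, 4], ![0, 0, 0, 0]⟩, ⟨![0, 0, 0, 3], ![0, 1, 0, 0]⟩, ⟨![0, 0, 0, 0], ![0, 3, 0, 0]⟩, ⟨![0, 0, 9, 0], ![0, 0, 0, 0]⟩, ⟨![0, 0, 0, 0], ![3, 1, 0, 0]⟩, ⟨![0, 0, 1, 0], ![4, 0, 0, 0]⟩, ⟨![0, 0, 0, 0], ![5, 0, 0, 0]⟩, ⟨![1, 0, 0, 4], ![0, 0, 0, 0]⟩, ⟨![0, 0, 0, 0], ![4, 0, 0, 1]⟩, ⟨![0, 0, 0, 0], ![0, 1, 3, 0]⟩, ⟨![1, 0, 0, 0], ![0, 0, 4, 0]⟩, ⟨![0, 0, 0, 0], ![0, 0, 5, 0]⟩, ⟨![0, 0, 0, 0], ![0, 0, 4, 1]⟩, ⟨![9,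 0, 0, 0], ![0, 0, 0, 0]⟩, ⟨![0, 0, 0, 0], ![0, 0, 0, 9]⟩, ⟨![0, 0, 3, 3], ![0, 0, 0, 0]⟩, ⟨![0, 0, 7, 1], ![0, 0, 0, 0]⟩, ⟨![0, 0, 7, 0], ![1, 0, 0, 0]⟩, ⟨![0, 0, 3, 0], ![3, 0, 0, 0]⟩, ⟨![1, 0, 8, 0], ![0, 0, 0, 0]⟩, ⟨![0, 0, 8, 0], ![0, 0, 0, 1]⟩, ⟨![3, 0, 0, 3], ![0, 0, 0, 0]⟩, ⟨![0, 0, 0, 0], ![3, 0, 0, 3]⟩, ⟨![3, 0, 0, 0], ![0, 0, 3, 0]⟩, ⟨![0, 0, 0, 0], ![0, 0, 3, 3]⟩, ⟨![7, 0, 0, 1], ![0, 0, 0, 0]⟩, ⟨![0, 0, 0, 0], ![1, 0, 0, 7]⟩, ⟨![8, 0, 1, 0], ![0, 0, 0, 0]⟩, ⟨![7, 0, 0, 0], ![0, 0, 1, 0]⟩, ⟨![0, 0, 0, 0], ![0, 0, 1, 7]⟩, ⟨![0, 0, 1, 0], ![0, 0, 0, 8]⟩, ⟨![8, 0, 0,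 0], ![0, 0, 0, 1]⟩, ⟨![1, 0, 0, 0], ![0, 0, 0, 8]⟩]) : ∀ i : Fin 7, ∃ n : ℕ,
    wordElem k PEmpty D (![pureWord 0, pureWord 2, pureWord 3, mixedWord 0, mixedWord 1, mixedWord 2, mixedWord 3] i) ^ n ∈ spanWords k PEmpty D GK := by
  have mem : ∀ b : Fin 34, wordElem k PEmpty D (GK b) ∈ spanWords k PEmpty D GK := fun b => Ideal.subset_span ⟨b, rfl⟩
  intro i
  fin_cases i
  · refine ⟨9, ?_⟩
    change wordElem k PEmpty D (pureWord 0) ^ 9 ∈ _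
    rw [pow_eq_wordElem k D (pureWord 0) (GK 14) 9 (by rw [hGK, hD]; decide)]; exact mem 14
  · refine ⟨9, ?_⟩
    change wordElem k PEmpty D (pureWord 2) ^ 9 ∈ _
    rw [pow_eq_wordElem k D (pureWord 2) (GK 4) 9 (by rw [hGK, hD]; decide)]; exact mem 4
  · refine ⟨5, ?_⟩
    change wordElem k PEmpty D (pureWord 3) ^ 5 ∈ _
    rw [pow_eq_wordElem k D (pureWord 3) (GK 0) 5 (by rw [hGK, hD]; decide)]; exact mem 0
  · refine ⟨5, ?_⟩
    change wordElem k PEmpty D (mixedWord 0) ^ 5 ∈ _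
    rw [pow_eq_wordElem k D (mixedWord 0) (GK 7) 5 (by rw [hGK, hD]; decide)]; exact mem 7
  · refine ⟨3, ?_⟩
    change wordElem k PEmpty D (mixedWord 1) ^ 3 ∈ _
    rw [pow_eq_wordElem k D (mixedWord 1) (GK 3) 3 (by rw [hGK, hD]; decide)]; exact mem 3
  · refine ⟨5, ?_⟩
    change wordElem k PEmpty D (mixedWord 2) ^ 5 ∈ _
    rw [pow_eq_wordElem k D (mixedWord 2) (GK 12) 5 (by rw [hGK, hD]; decide)]; exact mem 12
  · refine ⟨9, ?_⟩
    change wordElem k PEmpty D (mixedWord 3) ^ 9 ∈ _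
    rw [pow_eq_wordElem k D (mixedWord 3) (GK 15) 9 (by rw [hGK, hD]; decide)]; exact mem 15

/-! ## §3 The instance -/

/-- ★★★ **T″-INSTANCE #6 — THE RECURRENT MONOID HABITAT (every field, every `p`).** Let `U_R = Spec k[R]`, `k[R] = ToricChart.Ring k PEmpty D`
(`D = rDatum`, `≅ k[x₁,x₃,x₄,x₂x₃x₄,x₂x₄²,x₁x₂x₄,x₁x₂x₃]`), `x` its torus fixed point (the cone point `𝔪`) and `J = spanWords GJ` (`GJ = rJ`) the reduced ideal of `Sing U_R` (three curves through
`x`). Then `TStepInstanceAt p x (J̃·𝒪_{U_R,x})`: for every blowing up `S′ → Spec 𝒪_{U_R,x}` along `J` which is regular off the closed fibre and FULL at every stalk there is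
a fibre-supported ideal `𝓚 ≠ ⊥` on `S′` all of whose blowings up are regular — namely `𝓚 = K″·𝒪_{S′}` for the `𝔪`-primary `K″ = spanWords GK` (`GK = rK`), ONE blowing up, by the
product route (`TStepOfProduct.tStepInstanceAt_of_product`) over ✓ `RMonoidBlowup.blowup_regular` (`Bl_{J·K″} U_R` regular, 28 kernel-certified affine charts). The floor
`Bl_J U_R` is the one on which `𝓚 = I(Sing_red)` loops (res-L1-w45a-tri-2 TRIAGE #725). Non-vacuity (FULLness of the floor) is NOT claimed here — see the file docstring.
ONE instance; evidence for nothing beyond itself; T″ and the F-half stay OPEN. [OURS; folklore assembly; cite: StacksProject, Tag 080A; GortzWedhorn2020, Prop. 13.91 (2)] -/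
theorem tStepInstanceAt_recurrentMonoid
    (D : ConeDatum 4 4) (hD : D = ⟨![1, 0, 1, 1], ![![0, 1, 1, 1], ![0, 1, 0, 2], ![1, 1, 0, 1], ![1, 1, 1, 0]]⟩)
    (GJ : Fin 7 → Word 4 4) (hGJ : GJ = ![⟨![0, 0, 0, 1], ![0, 0, 0, 0]⟩, ⟨![0, 0, 0, 0], ![0, 1, 0, 0]⟩, ⟨![0, 0, 0, 0], ![1, 0, 0, 0]⟩, ⟨![1, 0, 1, 0], ![0, 0, 0, 0]⟩, ⟨![0, 0, 0, 0], ![0, 0, 1, 0]⟩, ⟨![0, 0, 1, 0], ![0, 0, 0, 1]⟩, ⟨![1, 0, 0, 0], ![0, 0, 0, 1]⟩])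
    (GK : Fin 34 → Word 4 4)
    (hGK : GK = ![⟨![0, 0, 0, 5], ![0, 0, 0, 0]⟩, ⟨![0, 0, 1, 4], ![0, 0, 0, 0]⟩, ⟨![0, 0, 0, 3], ![0, 1, 0, 0]⟩, ⟨![0, 0, 0, 0], ![0, 3, 0, 0]⟩, ⟨![0, 0, 9, 0], ![0, 0, 0, 0]⟩, ⟨![0, 0, 0, 0], ![3, 1, 0, 0]⟩, ⟨![0, 0, 1, 0], ![4, 0, 0, 0]⟩, ⟨![0, 0, 0, 0], ![5, 0, 0, 0]⟩, ⟨![1, 0, 0, 4], ![0, 0, 0, 0]⟩, ⟨![0, 0, 0, 0], ![4, 0, 0, 1]⟩, ⟨![0, 0, 0, 0], ![0, 1, 3, 0]⟩, ⟨![1, 0, 0, 0], ![0, 0, 4, 0]⟩, ⟨![0, 0, 0, 0], ![0, 0, 5, 0]⟩, ⟨![0, 0, 0, 0], ![0, 0, 4, 1]⟩, ⟨![9, 0, 0, 0], ![0, 0, 0, 0]⟩, ⟨![0, 0, 0, 0], ![0, 0, 0, 9]⟩, ⟨![0, 0, 3, 3], ![0, 0, 0, 0]⟩, ⟨![0, 0,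 7, 1], ![0, 0, 0, 0]⟩, ⟨![0, 0, 7, 0], ![1, 0, 0, 0]⟩, ⟨![0, 0, 3, 0], ![3, 0, 0, 0]⟩, ⟨![1, 0, 8, 0], ![0, 0, 0, 0]⟩, ⟨![0, 0, 8, 0], ![0, 0, 0, 1]⟩, ⟨![3, 0, 0, 3], ![0, 0, 0, 0]⟩, ⟨![0, 0, 0, 0], ![3, 0, 0, 3]⟩, ⟨![3, 0, 0, 0], ![0, 0, 3, 0]⟩, ⟨![0, 0, 0, 0], ![0, 0, 3, 3]⟩, ⟨![7, 0, 0, 1], ![0, 0, 0, 0]⟩, ⟨![0, 0, 0, 0], ![1, 0, 0, 7]⟩, ⟨![8, 0, 1, 0], ![0, 0, 0, 0]⟩, ⟨![7, 0, 0, 0], ![0, 0, 1, 0]⟩, ⟨![0, 0, 0, 0], ![0, 0, 1, 7]⟩, ⟨![0, 0, 1, 0], ![0, 0, 0, 8]⟩, ⟨![8, 0, 0, 0], ![0, 0, 0, 1]⟩, ⟨![1, 0, 0, 0], ![0, 0, 0, 8]⟩])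
    (p : ℕ) (x : Spec (.of (Ring k PEmpty D)))
    (hx : x.asIdeal = spanWords k PEmpty D ![pureWord 0, pureWord 2, pureWord 3, mixedWord 0, mixedWord 1, mixedWord 2, mixedWord 3]) :
    TStepGerm.TStepInstanceAt p x ((affineBlowup.idealSheaf (spanWords k PEmpty D GJ)).comap ((Spec (.of (Ring k PEmpty D))).fromSpecStalk x)) := by
  haveI : IsDomain (Ring k PEmpty D) := isDomain_ring
  haveI : IsNoetherianRing (Ring k PEmpty D) := isNoetherianRing_ring k PEmpty D
  -- `Bl_{J·K″}` is regular
  have hreg : Scheme.IsRegular (affineBlowup (spanWords k PEmpty D GJ * spanWords k PEmpty D GK)) := by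
    rw [spanWords_mul_spanWords]
    exact (RMonoidBlowup.blowup_regular k PEmpty D hD GJ hGJ GK hGK).1
  refine TStepOfProduct.tStepInstanceAt_of_product p x ?_ (spanWords k PEmpty D GJ) (spanWords k PEmpty D GK) ?_ ?_ hreg
  · -- `x ≠ η`
    rw [hx]
    intro h0
    have hmem : wordElem k PEmpty D (pureWord 0) ∈ spanWords k PEmpty D
        ![pureWord 0, pureWord 2, pureWord 3, mixedWord 0, mixedWord 1, mixedWord 2, mixedWord 3] := Ideal.subset_span ⟨0, rfl⟩
    rw [h0, Ideal.mem_bot] at hmem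
    exact wordElem_ne_zero _ hmem
  · -- `J ≠ ⊥`
    intro h0
    have hmem : wordElem k PEmpty D (GJ 0) ∈ spanWords k PEmpty D GJ := Ideal.subset_span ⟨0, rfl⟩
    rw [h0, Ideal.mem_bot] at hmem
    exact wordElem_ne_zero _ hmem
  · -- `V(K″) ⊆ {x}`
    have hmax : x.asIdeal.IsMaximal := by rw [hx]; exact isMaximal_conePoint k D hD
    exact TStepOfProduct.zeroLocus_subset_of_pow_mem x hmax _
      (fun l : Fin 7 => wordElem k PEmpty D (![pureWord 0, pureWord 2, pureWord 3, mixedWord 0, mixedWord 1, mixedWord 2, mixedWord 3] l))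
      (by rw [hx]; rfl) (pow_mem_K k D hD GK hGK)

/-- ★★★ **T″-INSTANCE #6, NAMED FORM**: the same for the tree's named bed `…RMonoidDefs.rDatum / rJ / rK` (✓p694456) — `TStepInstanceAt p x (J̃·𝒪_{U_R,x})` at the
cone point `x` of `U_R = Spec (ToricChart.Ring k PEmpty rDatum)` with floor `J = spanWords rJ` (`= I(Sing_red U_R)`), every field `k`, every `p`. [OURS · corollary] -/
theorem tStepInstanceAt_recurrentMonoid_rDatum (p : ℕ) (x : Spec (.of (Ring k PEmpty RMonoidDefs.rDatum)))
    (hx : x.asIdeal = spanWords k PEmpty RMonoidDefs.rDatum ![pureWord 0, pureWord 2, pureWord 3, mixedWord 0, mixedWord 1, mixedWord 2, mixedWord 3]) :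
    TStepGerm.TStepInstanceAt p x
      ((affineBlowup.idealSheaf (spanWords k PEmpty RMonoidDefs.rDatum RMonoidDefs.rJ)).comap ((Spec (.of (Ring k PEmpty RMonoidDefs.rDatum))).fromSpecStalk x)) :=
  tStepInstanceAt_recurrentMonoid k RMonoidDefs.rDatum rfl RMonoidDefs.rJ rfl RMonoidDefs.rK rfl p x hx

end Summit.ResolutionOfSingularities.ResolutionOfSingularities.Theorems.FInjectiveMacaulayfication.RMonoidTStep

end
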